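import Summits.ABC.IUTFork.Repair.RHSigmaSignedRemainder
import HarnessLib

/-!
# R-H ROUND 3 socket (generic): THE PARTIAL-CREDIT DOOR «cell `c` keeps the fraction `ω(c)` of its trivial mass ⟹ Cor. 3.12 up to the (1−ω)-weighted
# trivial mass» — the CELL-LEVEL law of START-HERE §0 as a kernel hypothesis shape, and the kept-mass bookkeeping

abc-iut cell, rung LADDER-ABC:A2.RESCUE.H, R-H seat abc-iut-rh2-q2-eq (gen 3). PROOF-ONLY sequel (0 definitions, 0 `Prop` facts, no instance, no notation)
of this seat's `RHSigmaSignedRemainder.lean` (p480491: `weightedDeficit`, `weightedTrivialMass`, THE WEIGHTED DOOR); companion `RHSigmaSlackAdapter.lean` (same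
date: the universal T-level adapter «`StatementUpTo ε` at the chosen bed ⟹ `T.negAbsLogQ ≤ T.negLogTheta + ε`»). Asked for by rh-lead g2's ROUND-3 START-HERE v1.0
(2026-08-27T01:25Z) §0/§2: a round-3 candidate «must state a CELL-LEVEL mass law: which cells `(j, w)` with `j > j₀(w)` it certifies, with what fraction
`c_j(w) ∈ [0,1]` of the cell's `(j²−1)`-weighted log-volume, from what cruder-than-identification input», and names this seat's weighted door as one of the
doors that carry such a law to F5/F5κ. The weighted door's hypothesis «`PN Σ ω·d ≤ 0`» is an AGGREGATE sign condition; the cell-level law of START-HERE is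
the CELLWISE condition typed here, and BOTH conclude the same weakened Corollary `StatementUpTo P (weightedTrivialMass P ω)`.

WHAT IS TYPED (generic: ANY `P : Cor312.Setting S` under the bridge hypotheses; `d(c) = cellDeficit`, `t(c) = cellTrivialCost ≥ 0`, `PN` = procession
normalisation; a weight `ω : cells → ℝ`, NO sign or size restriction unless stated):
* §1 **`statementUpTo_weightedTrivialMass_of_cellCredit`** — THE PARTIAL-CREDIT DOOR: the cellwise law [PC] «`d(c) ≤ (1 − ω(c))·t(c)` at every cell» gives
  `StatementUpTo P (weightedTrivialMass P ω)` = Cor. 3.12 weakened by `PN Σᶠ (1−ω)·t`. Reading: `ω(c) = 1` is the cell's licence-strength claim «`d(c) ≤ 0`»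
  (`cellCredit_one_iff`), `ω(c) = 0` claims nothing (`cellCredit_zero`, the trivial bound `d ≤ t` of p480491), `ω(c) = c_j(w) ∈ (0,1)` is START-HERE's
  «the object certifies the fraction `c_j(w)` of the cell's `(j²−1)`-mass»; the licence on `σ` IS [PC] for `ω = 1_σ` (`cellCredit_indicator_of_licenceOn`), so
  this door contains rh2-w-1's `statementUpTo_offTrivialMass_of_licenceOn` (p480491's `statementUpTo_offTrivialMass_of_licenceOn'`, not re-derived); the `_on` form takes
  the law on a set `s` of cells only (`ω ≤ 0` demanded off `s`). Bookkeeping: `weightedTrivialMass_add_compl` (`PN Σ (1−ω)t + PN Σ ω t = M`: the charged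
  mass is `M −` the KEPT mass `PN Σ ω·t = weightedTrivialMass P (1−ω)`), `weightedTrivialMass_anti` (more credit, less charge, for `t ≥ 0`),
  `weightedTrivialMass_le_iff_keptMass_ge` ([MU]-algebra: `PN Σ(1−ω)t ≤ κ·M + A ⟺ (1−κ)·M − A ≤ PN Σ ω·t` — the relative tolerance of the exponent
  programme reads «kept ω-mass ≥ μ₀·M − Tol», `μ₀ = 1−κ`).
* The T-level forms (chosen realising ideles: `T.negAbsLogQ ≤ T.negLogTheta + weightedTrivialMass … ω` from [PC] / from the weighted door) are the
  companion's `cor312UpTo_weightedTrivialMass_of_weightedDeficit_nonpos_chosen` and the sequel's cell-credit twin — abc-iut-rh2-q2-cond's [NUMΣ-C] binder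
  with `ε := PN Σᶠ (1−ω)·t`, leaving the relative tolerance [MU-C] «kept ω-mass ≥ μ₀·T.gap − Tol(P,l)» as the one content binder of the exponent end.
HONEST FRAMING: implications about OUR typed objects; [PC] / «`weightedDeficit ≤ 0`» are ASSUMPTION SHAPES, never asserted for any datum or candidate;
nothing here asserts that abc is proved or refuted, or that [IUTchIII] Cor. 3.12 holds or fails at any datum, or takes a side on any author
(Mochizuki / Scholze–Stix / Joshi / Dupuy–Hilado); typed ≠ proved; instantiated ≠ endorsed. [claim: Mochizuki2012, status: disputed] for every IUT locution.
[cite: Mochizuki2012, IUTchIII Cor. 3.12 p. 173–174, Prop. 3.9 (i)(iii) p. 116; IUTchI Ex. 3.2 (iv) p. 71] [cite: DupuyHilado2025, §3.9]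
-/

noncomputable section

open Set Function NumberField IsDedekindDomain

/-! ## §1. Generic: the partial-credit (cellwise) door and the kept-mass bookkeeping -/

namespace Summit.ABC.IUTFork.Repair.RH.SigmaLicence

open Summit.ABC.IUTFork.Thm311 Summit.ABC.IUTFork.Cor312 Summit.ABC.IUTFork.Cor312.Setting Summit.ABC.IUTFork.Cor312Vol
  Literature.IUT.LogThetaLattice Summit.ABC.IUTFork.Repair.RH.SigmaMass

variable {T : ThetaIndex} {S : Situation T} {P : Cor312.Setting S}

/-- **THE PARTIAL-CREDIT DOOR (cellwise).** Under the bridge hypotheses, for ANY weight `ω` on cells: the cell-level law [PC] «`cellDeficit(c) ≤ (1 − ω(c))·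
cellTrivialCost(c)` at every cell» gives Cor. 3.12 weakened by the (1−ω)-weighted trivial mass, `StatementUpTo P (weightedTrivialMass P ω)`. Proof:
`D = PN Σᶠ d ≤ PN Σᶠ (1−ω)·t` cell by cell (p479556 `statementUpTo_iff_avg_cellDeficit_le`). ROUND-3 reading: `ω(c) = c_j(w)`, the fraction of the cell's
`(j²−1)`-mass the candidate certifies. «follows AS TYPED»; [PC] is an assumption shape. [cite: Mochizuki2012, IUTchIII Cor. 3.12 p. 173–174]
[claim: Mochizuki2012, status: disputed] -/
theorem statementUpTo_weightedTrivialMass_of_cellCredit (H : BridgeHyps P) {ω : Fin T.lstar × T.VQ → ℝ}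
    (h : ∀ c : Fin T.lstar × T.VQ, cellDeficit P c.1 c.2 ≤ (1 - ω c) * cellTrivialCost P c) :
    StatementUpTo P (weightedTrivialMass P ω) := by
  rw [statementUpTo_iff_signedRemainder_le H]
  unfold signedRemainder weightedTrivialMass processionNormalized
  refine div_le_div_of_nonneg_right (Finset.sum_le_sum fun i _ => ?_) (Nat.cast_nonneg _)
  exact finsum_le_finsum' (cellDeficit_support_finite H i) (weightedTrivialMass_support_finite H ω i) fun vQ => h (i, vQ)

/-- Budget form of the partial-credit door: [PC] and `weightedTrivialMass P ω ≤ ε` give `StatementUpTo P ε`. [claim: Mochizuki2012, status: disputed] -/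
theorem statementUpTo_of_cellCredit_of_le (H : BridgeHyps P) {ω : Fin T.lstar × T.VQ → ℝ}
    (h : ∀ c : Fin T.lstar × T.VQ, cellDeficit P c.1 c.2 ≤ (1 - ω c) * cellTrivialCost P c) {ε : ℝ}
    (hε : weightedTrivialMass P ω ≤ ε) : StatementUpTo P ε :=
  statementUpTo_mono hε (statementUpTo_weightedTrivialMass_of_cellCredit H h)

/-- `ω(c) = 0` claims nothing: `d(c) ≤ (1 − 0)·t(c)` is p480491's trivial bound `cellDeficit_le_cellTrivialCost`. [claim: Mochizuki2012, status: disputed] -/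
theorem cellCredit_zero (H : BridgeHyps P) (c : Fin T.lstar × T.VQ) : cellDeficit P c.1 c.2 ≤ (1 - 0) * cellTrivialCost P c := by
  rw [sub_zero, one_mul]
  exact cellDeficit_le_cellTrivialCost H c

/-- More generally any `ω(c) ≤ 0` claims nothing (`(1−ω)·t ≥ t ≥ d`). [claim: Mochizuki2012, status: disputed] -/
theorem cellCredit_of_nonpos (H : BridgeHyps P) {ω : Fin T.lstar × T.VQ → ℝ} {c : Fin T.lstar × T.VQ} (hω : ω c ≤ 0) :
    cellDeficit P c.1 c.2 ≤ (1 - ω c) * cellTrivialCost P c :=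
  (cellDeficit_le_cellTrivialCost H c).trans
    (le_mul_of_one_le_left (cellTrivialCost_nonneg c) (by linarith))

/-- `ω(c) = 1` is the licence-strength claim «`d(c) ≤ 0`» at the cell. [folklore] -/
theorem cellCredit_one_iff (c : Fin T.lstar × T.VQ) :
    cellDeficit P c.1 c.2 ≤ (1 - 1) * cellTrivialCost P c ↔ cellDeficit P c.1 c.2 ≤ 0 := by
  rw [sub_self, zero_mul]

/-- **The cellwise licence IS the partial-credit law of the indicator weight**: `LicenceOn P σ ⟹` [PC] for `ω = 1_σ` (licensed cells claim `1`, the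
others `0`). [claim: Mochizuki2012, status: disputed] -/
theorem cellCredit_indicator_of_licenceOn (H : BridgeHyps P) {σ : Set (Fin T.lstar × T.VQ)} (hσ : LicenceOn P σ)
    (c : Fin T.lstar × T.VQ) :
    cellDeficit P c.1 c.2 ≤ (1 - σ.indicator (fun _ => (1 : ℝ)) c) * cellTrivialCost P c := by
  by_cases hc : c ∈ σ
  · rw [Set.indicator_of_mem hc, sub_self, zero_mul]
    exact cellDeficit_nonpos_of_licenceOn H hσ hc
  · rw [Set.indicator_of_notMem hc]
    exact cellCredit_zero H c

/-- **The partial-credit door with the law given on a set `s` of cells only** (off `s` the weight claims nothing: `ω ≤ 0` there).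
[claim: Mochizuki2012, status: disputed] -/
theorem statementUpTo_weightedTrivialMass_of_cellCredit_on (H : BridgeHyps P) {ω : Fin T.lstar × T.VQ → ℝ} (s : Set (Fin T.lstar × T.VQ))
    (hon : ∀ c ∈ s, cellDeficit P c.1 c.2 ≤ (1 - ω c) * cellTrivialCost P c) (hoff : ∀ c ∉ s, ω c ≤ 0) :
    StatementUpTo P (weightedTrivialMass P ω) :=
  statementUpTo_weightedTrivialMass_of_cellCredit H fun c => by
    by_cases hc : c ∈ s
    · exact hon c hc
    · exact cellCredit_of_nonpos H (hoff c hc)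

/-- **Licence on `σ` PLUS partial credit off `σ`**: `LicenceOn P σ`, and [PC] at the cells outside `σ` for a weight `ω`, give Cor. 3.12 up to
`PN Σᶠ_{c ∉ σ} (1−ω(c))·t(c)` — the weight `1` on `σ`, `ω` off `σ` (START-HERE §0: licence below `j₀(w)`, a fraction `c_j(w)` above).
[claim: Mochizuki2012, status: disputed] -/
theorem statementUpTo_of_licenceOn_of_cellCredit_off (H : BridgeHyps P) {σ : Set (Fin T.lstar × T.VQ)} (hσ : LicenceOn P σ)
    {ω : Fin T.lstar × T.VQ → ℝ} (hoff : ∀ c ∉ σ, cellDeficit P c.1 c.2 ≤ (1 - ω c) * cellTrivialCost P c) :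
    StatementUpTo P (weightedTrivialMass P (fun c => σ.indicator (fun _ => (1 : ℝ)) c + σᶜ.indicator ω c)) := by
  refine statementUpTo_weightedTrivialMass_of_cellCredit H fun c => ?_
  by_cases hc : c ∈ σ
  · rw [Set.indicator_of_mem hc, Set.indicator_of_notMem (Set.notMem_compl_iff.mpr hc), add_zero, sub_self, zero_mul]
    exact cellDeficit_nonpos_of_licenceOn H hσ hc
  · rw [Set.indicator_of_notMem hc, Set.indicator_of_mem (Set.mem_compl hc), zero_add]
    exact hoff c hc

/-- **Charged mass + kept mass = total mass**: `weightedTrivialMass P ω + weightedTrivialMass P (1 − ω) = M` (`PN Σ(1−ω)t + PN Σ ω t = PN Σ t`).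
[folklore] -/
theorem weightedTrivialMass_add_compl (H : BridgeHyps P) (ω : Fin T.lstar × T.VQ → ℝ) :
    weightedTrivialMass P ω + weightedTrivialMass P (fun c => 1 - ω c) = totalTrivialMass P := by
  unfold weightedTrivialMass totalTrivialMass processionNormalized
  rw [← add_div, ← Finset.sum_add_distrib]
  congr 1
  refine Finset.sum_congr rfl fun i _ => ?_
  rw [← finsum_add_distrib (weightedTrivialMass_support_finite H ω i) (weightedTrivialMass_support_finite H (fun c => 1 - ω c) i)]
  exact finsum_congr fun vQ => by ring

/-- The KEPT ω-mass `PN Σᶠ ω·t` is `weightedTrivialMass P (1 − ω)`, spelled out. [folklore] -/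
theorem weightedTrivialMass_compl_eq (ω : Fin T.lstar × T.VQ → ℝ) :
    weightedTrivialMass P (fun c => 1 - ω c) =
      processionNormalized fun i : Fin T.lstar => ∑ᶠ vQ : T.VQ, ω (i, vQ) * cellTrivialCost P (i, vQ) := by
  unfold weightedTrivialMass
  simp only [sub_sub_cancel]

/-- The charged mass is `M −` the kept mass. [folklore] -/
theorem weightedTrivialMass_eq_totalTrivialMass_sub (H : BridgeHyps P) (ω : Fin T.lstar × T.VQ → ℝ) :
    weightedTrivialMass P ω = totalTrivialMass P - weightedTrivialMass P (fun c => 1 - ω c) := by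
  rw [← weightedTrivialMass_add_compl H ω, add_sub_cancel_right]

/-- **More credit, less charge**: `ω ≤ ω'` cellwise ⟹ `weightedTrivialMass P ω' ≤ weightedTrivialMass P ω` (`t ≥ 0`). [folklore] -/
theorem weightedTrivialMass_anti (H : BridgeHyps P) {ω ω' : Fin T.lstar × T.VQ → ℝ} (hle : ∀ c, ω c ≤ ω' c) :
    weightedTrivialMass P ω' ≤ weightedTrivialMass P ω := by
  unfold weightedTrivialMass processionNormalized
  refine div_le_div_of_nonneg_right (Finset.sum_le_sum fun i _ => ?_) (Nat.cast_nonneg _)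
  refine finsum_le_finsum' (weightedTrivialMass_support_finite H ω' i) (weightedTrivialMass_support_finite H ω i) fun vQ => ?_
  exact mul_le_mul_of_nonneg_right (by linarith [hle (i, vQ)]) (cellTrivialCost_nonneg (i, vQ))

/-- `0 ≤ ω ≤ 1` ⟹ `0 ≤ weightedTrivialMass P ω ≤ M`. [folklore] -/
theorem weightedTrivialMass_mem_Icc (H : BridgeHyps P) {ω : Fin T.lstar × T.VQ → ℝ} (h0 : ∀ c, 0 ≤ ω c) (h1 : ∀ c, ω c ≤ 1) :
    0 ≤ weightedTrivialMass P ω ∧ weightedTrivialMass P ω ≤ totalTrivialMass P := by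
  constructor
  · have h := weightedTrivialMass_anti H h1
    rwa [weightedTrivialMass_one] at h
  · have h := weightedTrivialMass_anti H h0
    rwa [weightedTrivialMass_zero] at h

/-- **[MU]-algebra for weights**: `weightedTrivialMass P ω ≤ κ·M + A ⟺ (1−κ)·M − A ≤ PN Σᶠ ω·t` — the exponent programme's relative tolerance on the
charged mass is «kept ω-mass `≥ μ₀·M − A`» with `μ₀ = 1 − κ` (abc-iut-rh2-T-1's `massThreshold_le_onTrivialMass_iff` for `ω = 1_σ`). [folklore] -/
theorem weightedTrivialMass_le_iff_keptMass_ge (H : BridgeHyps P) (ω : Fin T.lstar × T.VQ → ℝ) (κ A : ℝ) :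
    weightedTrivialMass P ω ≤ κ * totalTrivialMass P + A ↔
      (1 - κ) * totalTrivialMass P - A ≤ weightedTrivialMass P (fun c => 1 - ω c) := by
  rw [weightedTrivialMass_eq_totalTrivialMass_sub H ω]
  constructor <;> intro h <;> linarith

/-- The partial-credit door and the weighted door side by side: [PC] for `ω` AND `0 ≤ ω` give the weighted door's aggregate hypothesis up to the kept
charge — `weightedDeficit P ω ≤ PN Σᶠ ω(1−ω)·t`; in particular for a `{0,1}`-valued `ω` (a stratum) [PC] implies `weightedDeficit P ω ≤ 0`.
[claim: Mochizuki2012, status: disputed] -/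
theorem weightedDeficit_nonpos_of_cellCredit_of_indicator (σ : Set (Fin T.lstar × T.VQ))
    (h : ∀ c : Fin T.lstar × T.VQ, cellDeficit P c.1 c.2 ≤ (1 - σ.indicator (fun _ => (1 : ℝ)) c) * cellTrivialCost P c) :
    weightedDeficit P (σ.indicator fun _ => 1) ≤ 0 := by
  rw [weightedDeficit_indicator]
  unfold processionNormalized
  have hle : ∀ (i : Fin T.lstar) (vQ : T.VQ),
      σ.indicator (fun c : Fin T.lstar × T.VQ => cellDeficit P c.1 c.2) (i, vQ) ≤ 0 := by
    intro i vQ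
    by_cases hc : (i, vQ) ∈ σ
    · rw [Set.indicator_of_mem hc]
      have h' := h (i, vQ)
      rw [Set.indicator_of_mem hc, sub_self, zero_mul] at h'
      exact h'
    · rw [Set.indicator_of_notMem hc]
  have hsum : ∀ i : Fin T.lstar,
      ∑ᶠ vQ : T.VQ, σ.indicator (fun c : Fin T.lstar × T.VQ => cellDeficit P c.1 c.2) (i, vQ) ≤ 0 := by
    intro i
    have h' := finsum_nonneg (f := fun vQ : T.VQ =>
      -σ.indicator (fun c : Fin T.lstar × T.VQ => cellDeficit P c.1 c.2) (i, vQ)) fun vQ => neg_nonneg.mpr (hle i vQ)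
    rw [finsum_neg_distrib] at h'
    exact neg_nonneg.mp h'
  exact div_nonpos_iff.mpr (Or.inr ⟨Finset.sum_nonpos fun i _ => hsum i, Nat.cast_nonneg _⟩)

end Summit.ABC.IUTFork.Repair.RH.SigmaLicence

end
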